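import Mathlib.Probability.Moments.SubGaussian
import Mathlib.MeasureTheory.Measure.Real
import Mathlib.Analysis.InnerProductSpace.Continuous
import Mathlib.Analysis.SpecialFunctions.Trigonometric.Basic
import HarnessLib

/-!
# Hoeffding's inequality with one-sided mean bounds; the cosine test of Aharonov–Regev / Micciancio–Regev

Topic `Probability/Moments`. Two fully PROVED corollaries of Mathlib's Hoeffding inequality
(`ProbabilityTheory.hasSubgaussianMGF_of_mem_Icc`,
`ProbabilityTheory.HasSubgaussianMGF.measure_sum_ge_le_of_iIndepFun`), in the form in which
Micciancio–Regev (*Worst-case to average-case reductions based on Gaussian measures*, SIAM J. Comput.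
37 (2007), eq. (14) p. 27) and Aharonov–Regev (J. ACM 52 (2005), eq. (2)) use it: the summands are
independent, bounded, NOT identically distributed, and only an UPPER bound on their means is known.

* `measureReal_le_sum_le_exp_of_integral_le` — for independent `Xᵢ ∈ [a, b]` (a.s.) with
  `E Xᵢ ≤ μ`, and `δ ≥ 0`: `Pr[∑_{i ∈ s} Xᵢ ≥ #s (μ + δ)] ≤ exp(-2 #s δ²/(b - a)²)` (MR07 (14):
  "`Pr{S_N ≥ Exp[S_N] + Nε} ≤ e^{-2Nε²/(b-a)²}`", here with `Exp[S_N]` replaced by any upper bound).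
* `MicciancioRegev2007.measureReal_half_le_sum_cos_div_le` — **test (b) of the verifier in the proof
  of MR07 Thm. 5.23** (authors' version p. 30; Aharonov–Regev 2005 §6.2): if `w₁, …, w_N` are
  independent random vectors and `E cos(2π⟨t, wᵢ⟩) ≤ μ ≤ 1/2` for each `i` (MR07 eq. (16):
  `μ = 2⁻ⁿ⁺¹`), then `Pr[f_W(t) ≥ 1/2] ≤ exp(-N (1/2 - μ)²/2)` where
  `f_W(t) = N⁻¹ ∑ᵢ cos(2π⟨t, wᵢ⟩)`; the event is literally the negation of test (b) as consumed by
  `Literature.Algebra.EuclideanLattices.half_le_sum_cos_div_card_of_norm_sub_le`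
  (`MRVerifierSoundness.lean`). (Print: "`f_W(t) ≥ 1/2` with probability at most
  `e^{-N(1/2 - Exp[f_W(t)])²/4} = 2^{-Ω(N)}`"; the exponent here is the sharper `/2`.)

Written for the decomposition of MR07 Thm. 5.23
(`Literature.Computability.Cryptography.MicciancioRegev2007_gapCVP'_to_SIS'`); Mathlib only.

## References

* D. Micciancio, O. Regev, *Worst-case to average-case reductions based on Gaussian measures*,
  SIAM J. Comput. 37 (2007) 267–302; authors' version, eq. (14) (p. 27), proof of Thm. 5.23, test (b)
  (p. 30) (`lit read doi:10.1137/S0097539705447360`).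
* D. Aharonov, O. Regev, *Lattice problems in NP ∩ coNP*, J. ACM 52 (2005) 749–765, §6.2.
* W. Hoeffding, *Probability inequalities for sums of bounded random variables*, JASA 58 (1963), Thm. 2.
-/

noncomputable section

open MeasureTheory ProbabilityTheory Finset
open scoped NNReal InnerProductSpace RealInnerProductSpace Real

namespace Literature.Probability.Moments

variable {Ω : Type*} [MeasurableSpace Ω] {P : Measure Ω} [IsProbabilityMeasure P] {ι : Type*}

/-- **Hoeffding's inequality with upper bounds on the means** (Hoeffding 1963 Thm. 2; MR07 eq. (14)):
independent `Xᵢ` with values a.s. in `[a, b]` and `E Xᵢ ≤ μ` satisfy, for every finite set `s` of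
indices and `δ ≥ 0`, `Pr[#s (μ + δ) ≤ ∑_{i ∈ s} Xᵢ] ≤ exp(-2 #s δ² / (b - a)²)`.
[cite: Hoeffding1963, Thm. 2] -/
theorem measureReal_le_sum_le_exp_of_integral_le {X : ι → Ω → ℝ} (hind : iIndepFun X P)
    (hmeas : ∀ i, AEMeasurable (X i) P) {a b : ℝ} (hX : ∀ i, ∀ᵐ ω ∂P, X i ω ∈ Set.Icc a b)
    {μ : ℝ} (hμ : ∀ i, ∫ ω, X i ω ∂P ≤ μ) {δ : ℝ} (hδ : 0 ≤ δ) (s : Finset ι) :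
    P.real {ω | s.card * (μ + δ) ≤ ∑ i ∈ s, X i ω} ≤
      Real.exp (-(2 * s.card * δ ^ 2 / (b - a) ^ 2)) := by
  classical
  set c : ℝ≥0 := (‖b - a‖₊ / 2) ^ 2 with hc
  have hsubG : ∀ i, HasSubgaussianMGF (fun ω => X i ω - ∫ ω', X i ω' ∂P) c P := fun i =>
    hasSubgaussianMGF_of_mem_Icc (hmeas i) (hX i)
  -- independence of the centred variables
  have hindY : iIndepFun (fun i ω => X i ω - ∫ ω', X i ω' ∂P) P :=
    hind.comp (fun i x => x - ∫ ω', X i ω' ∂P) fun i => measurable_id.sub_const _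
  have hH := HasSubgaussianMGF.measure_sum_ge_le_of_iIndepFun hindY (c := fun _ => c) (s := s)
    (fun i _ => hsubG i) (ε := s.card * δ) (by positivity)
  have hsub : {ω | (s.card : ℝ) * (μ + δ) ≤ ∑ i ∈ s, X i ω} ⊆
      {ω | (s.card : ℝ) * δ ≤ ∑ i ∈ s, (X i ω - ∫ ω', X i ω' ∂P)} := by
    intro ω hω
    simp only [Set.mem_setOf_eq] at hω ⊢
    rw [Finset.sum_sub_distrib]
    have : ∑ i ∈ s, ∫ ω', X i ω' ∂P ≤ s.card * μ := by
      calc ∑ i ∈ s, ∫ ω', X i ω' ∂P ≤ ∑ _i ∈ s, μ := Finset.sum_le_sum fun i _ => hμ i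
        _ = s.card * μ := by rw [Finset.sum_const, nsmul_eq_mul]
    linarith
  refine (measureReal_mono hsub).trans (hH.trans (le_of_eq ?_))
  congr 1
  have hcR : (c : ℝ) = ((b - a) / 2) ^ 2 := by
    rw [hc]; push_cast; rw [Real.norm_eq_abs, div_pow, sq_abs, div_pow]
  rw [Finset.sum_const, nsmul_eq_mul]
  push_cast
  rw [hcR]
  rcases eq_or_ne a b with hab | hab
  · subst hab; simp
  · have hba : (b - a) ≠ 0 := sub_ne_zero.2 (Ne.symm hab)
    rcases Nat.eq_zero_or_pos s.card with h0 | hpos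
    · simp [h0]
    · have : (0 : ℝ) < s.card := by exact_mod_cast hpos
      field_simp

variable {V : Type*} [NormedAddCommGroup V] [InnerProductSpace ℝ V] [MeasurableSpace V] [BorelSpace V]

/-- **Test (b) of the MR07 / Aharonov–Regev verifier fails only with exponentially small probability**
(Micciancio–Regev 2007, proof of Thm. 5.23, p. 30): if `w₁, …, w_N` are independent random vectors
with `E cos(2π⟨t, wᵢ⟩) ≤ μ ≤ 1/2` for every `i`, then
`Pr[1/2 ≤ N⁻¹ ∑ᵢ cos(2π⟨t, wᵢ⟩)] ≤ exp(-N (1/2 - μ)²/2)` (Hoeffding with `Xᵢ = cos(2π⟨t, wᵢ⟩) ∈ [-1, 1]`,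
`δ = 1/2 - μ`). [cite: MicciancioRegev2007, Thm. 5.23 (proof, test (b), authors' version p. 30)] -/
theorem MicciancioRegev2007.measureReal_half_le_sum_cos_div_le [Fintype ι] {w : ι → Ω → V}
    (hind : iIndepFun w P) (hmeas : ∀ i, AEMeasurable (w i) P) (t : V) {μ : ℝ}
    (hμ : ∀ i, ∫ ω, Real.cos (2 * π * ⟪t, w i ω⟫) ∂P ≤ μ) (hμhalf : μ ≤ 1 / 2) :
    P.real {ω | 1 / 2 ≤ (∑ i, Real.cos (2 * π * ⟪t, w i ω⟫)) / Fintype.card ι} ≤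
      Real.exp (-(Fintype.card ι * (1 / 2 - μ) ^ 2 / 2)) := by
  classical
  set N : ℕ := Fintype.card ι with hN
  rcases Nat.eq_zero_or_pos N with hN0 | hNpos
  · -- no samples: the average is `0 < 1/2`
    have : {ω | 1 / 2 ≤ (∑ i, Real.cos (2 * π * ⟪t, w i ω⟫)) / (N : ℝ)} = ∅ := by
      ext ω
      simp [hN0]
    rw [this, measureReal_empty]
    positivity
  set φ : V → ℝ := fun x => Real.cos (2 * π * ⟪t, x⟫) with hφ
  have hφm : Measurable φ :=
    (Real.continuous_cos.comp (continuous_const.mul (continuous_const.inner continuous_id))).measurable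
  set X : ι → Ω → ℝ := fun i ω => φ (w i ω) with hX
  have hXind : iIndepFun X P := hind.comp (fun _ => φ) fun _ => hφm
  have hXmeas : ∀ i, AEMeasurable (X i) P := fun i => hφm.comp_aemeasurable (hmeas i)
  have hXbd : ∀ i, ∀ᵐ ω ∂P, X i ω ∈ Set.Icc (-1 : ℝ) 1 := fun i =>
    ae_of_all _ fun ω => ⟨Real.neg_one_le_cos _, Real.cos_le_one _⟩
  have hH := measureReal_le_sum_le_exp_of_integral_le hXind hXmeas hXbd hμ
    (δ := 1 / 2 - μ) (by linarith) Finset.univ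
  have hNR : (0 : ℝ) < N := by exact_mod_cast hNpos
  have hsub : {ω | 1 / 2 ≤ (∑ i, Real.cos (2 * π * ⟪t, w i ω⟫)) / (N : ℝ)} ⊆
      {ω | ((Finset.univ : Finset ι).card : ℝ) * (μ + (1 / 2 - μ)) ≤ ∑ i ∈ Finset.univ, X i ω} := by
    intro ω hω
    simp only [Set.mem_setOf_eq, Finset.card_univ, ← hN] at hω ⊢
    rw [le_div_iff₀ hNR] at hω
    have : ∑ i, X i ω = ∑ i, Real.cos (2 * π * ⟪t, w i ω⟫) := rfl
    linarith
  refine (measureReal_mono hsub).trans (hH.trans (le_of_eq ?_))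
  rw [Finset.card_univ, ← hN]
  congr 1
  ring

end Literature.Probability.Moments

end
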